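import Literature.AnabelianGeometry.SemiGraphs.PSCTwoComponentAffineFreeFactors
import Literature.AnabelianGeometry.SemiGraphs.PSCTwoComponentAffineOrigin
import Literature.AnabelianGeometry.SemiGraphs.PSCGraphicConverseIncidence
import HarnessLib

/-!
# [CombGC] Prop. 1.2 (ii), Prop. 1.5 (i)(ii) HOLD at the origin of genuine two-component affine data

Mochizuki, *A combinatorial version of the Grothendieck conjecture* [CombGC] §1: Prop. 1.2 (ii) p. 8
(commensurable terminality), Prop. 1.5 (i) p. 12 (incidence of edge-like subgroups), Prop. 1.5 (ii) p. 13
("`α` is graphic if and only if it is group-theoretically edge-like and group-theoretically verticial;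
then it arises from a unique isomorphism of semi-graphs") [cite: MochizukiCombGC2007, Prop 1.5(ii) p.13]
[cite: MochizukiCombGC2007, Prop 1.5(i) p.12] [cite: MochizukiCombGC2007, Prop 1.2(ii) p.8].
PROOF-ONLY assembly file (abc-iut-f-164 gen 3; abc-iut FACT-LIST rows F-0438
`PSCDatum.CommensurableTerminalityHolds`, F-0440 `PSCDatum.EdgeLikeIncidenceHolds`, F-0443
`PSCDatum.GraphicIffEdgeLikeVerticialHolds` — schemata over the origin parameter `Ω : PSCOrigin` typed by
abc-iut-L3-t4; universal closures refuted, instance forms the content).  Sequel of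
`PSCTwoComponentAffineFreeFactors.lean` (the datum-level rows via ONE free basis of `Γ_{g,r}`) and of
abc-iut-f-164 gen 2's `PSCTwoComponentAffineOrigin.lean` (F-0459 / F-1931 / F-0458 at the same data).

## The origin

The ORIGIN OF TWO-COMPONENT AFFINE DATA (recording the node's end vertices): data over a profinite `Π`
presented by a pro-`Σ` completion `ι : Γ_{g,r} → Π`, two vertices `v₀`, `v₁` and one node `ν` with
`nodeEnds ν = s(v₀, v₁)`, cusps `≃ Fin r` with the closed cusp inertia groups, handles `i < g₀` and cusps
`s ≤ j` on `C₀` (`r − s ≥ 2` of them), the others on `C₁` (`s ≥ 2`), `Π_{v₀}`, `Π_{v₁}`, `Π_ν = cl ι⟨ε⟩` the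
closures of the two subsurface groups and of the node loop, genera `g₀`, `g − g₀` (shape hypotheses of
`PSCTwoComponentAffineShape.lean`, plus `nodeEnds`).

* `twoComponentAffineOrigin_rows` — at every such origin (any genera, any `Σ`), in one conjunction:
  F-0459 (gen 2, re-derived), **F-0440**, **F-0443** (by abc-iut-w4-d081's reduction
  `graphicIffEdgeLikeVerticialHolds_of_incidence` fed with F-0459, F-0440 and the branch link
  `Π_ν ≤ Π_{v₀}`, `Π_ν ≤ Π_{v₁}`, `Π_{v₀} ≠ Π_{v₁}`), the first clause of F-0438 at every datum, and **F-0438**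
  (both clauses) when every datum has a component of genus `< 2` (the sturdy `Π^unr`-clause is vacuous
  there; HONEST SCOPE: for sturdy data it would need commensurable terminality of the image of `Π_v` in the
  free pro-`Σ` product `Π^unr`, not in the tree); `unrVerticialIffHolds_of_genus_lt_two` — F-0461 is
  VACUOUS at non-sturdy origins;
* `exists_twoComponentAffineOrigin_prop15_holds` — for a prime `l`, the origin of two-component affine data
  with `Σ = {l}` (INHABITED for every hyperbolic splitting: `exists_twoComponentAffineDatum`, e.g. by the
  sturdy datum over `Γ_{4,4}`) satisfies F-0459 ∧ F-0440 ∧ F-0443 ∧ F-1931 ∧ F-0458, and the first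
  clause of F-0438 datum-wise; `exists_twoComponentAffineOrigin_prop12ii_holds` — the sub-origin with
  `g₀ ≤ 1` (a component of genus `≤ 1`; inhabited by `Γ_{1+g₁, r}`-data, e.g. an elliptic and a genus-`g₁`
  component) satisfies in addition F-0438 in full (and F-0461 vacuously: `unrVerticialIffHolds_of_genus_lt_two`).

Instance forms at data of the shape of genuine two-component curves: consistency evidence for the typed
schemata, not the printed theorems for all pointed stable curves (cell FOUNDATIONS rows 13–14).  0
definitions; nothing here takes a side on [IUTchIII] Cor. 3.12.
-/

noncomputable section

namespace Literature.AnabelianGeometry.SemiGraphs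

open scoped Pointwise
open Literature.GroupTheory.CombinatorialGroupTheory
open SemiGraphOfAnabelioids (IsProSigmaCompletion)

universe u

namespace PSCDatum

/-! ### All rows at an origin of two-component affine data (one theorem, explicit origin hypothesis) -/

/-- **[CombGC] Prop. 1.2 (i)(ii), Prop. 1.5 (i)(ii) at every origin of two-component affine data** (any
genera, any `Σ`), from the origin hypothesis `hΩ` (the shape, with `nodeEnds` recorded), as ONE conjunction:
(1) F-0459 (gen 2, re-derived); (2) **F-0440** — "an edge-like subgroup is cuspidal iff contained in exactly
one verticial subgroup, the node's in exactly two"; (3) **F-0443** — "`α` is graphic iff group-theoretically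
edge-like and verticial; then it arises from a unique isomorphism of semi-graphs", by abc-iut-w4-d081's
reduction `graphicIffEdgeLikeVerticialHolds_of_incidence` fed with (1), (2) and the branch link
(`branchLink_of_twoComponentAffine`); (4) the first clause of F-0438 at every datum; (5) **F-0438** in full
provided every datum has a component of genus `< 2` (sturdy `Π^unr`-clause vacuous; NOT treated for sturdy
data); (6) the origin hypothesis in the shape of gen 2's `PSCTwoComponentAffineOrigin.lean`, for its F-1931 /
F-0458 theorems. [cite: MochizukiCombGC2007, Prop 1.5(ii) p.13] [cite: MochizukiCombGC2007, Prop 1.5(i) p.12]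
[cite: MochizukiCombGC2007, Prop 1.2(ii) p.8] -/
theorem twoComponentAffineOrigin_rows (Ω : PSCOrigin.{u})
    (hΩ : ∀ ⦃Q : Type u⦄ [Group Q] [TopologicalSpace Q] (G : PSCDatum Q),
      Ω.IsOfPSCType G → ∃ (_ : IsTopologicalGroup Q), CompactSpace Q ∧ T2Space Q ∧
        TotallyDisconnectedSpace Q ∧
        ∃ (S : Set ℕ) (g r g₀ s : ℕ) (ι : PuncturedSurfaceGroup g r →* Q) (e : G.graph.C ≃ Fin r)
          (v₀ v₁ : G.graph.V) (n₀ : G.graph.N) (ε : PuncturedSurfaceGroup g r),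
          S.Nonempty ∧ (∀ p ∈ S, p.Prime) ∧ IsProSigmaCompletion S ι ∧ g₀ ≤ g ∧ 2 ≤ s ∧ s + 2 ≤ r ∧
          (∀ c, G.cuspGp c =
            ((PuncturedSurfaceGroup.cuspInertia (g := g) (e c)).map ι).topologicalClosure) ∧
          (∀ w, w = v₀ ∨ w = v₁) ∧ (∀ n, n = n₀) ∧
          ε = ((List.finRange r).map fun j : Fin r =>
            if s ≤ (j : ℕ) then PuncturedSurfaceGroup.c (g := g) j else 1).prod *
          ((List.finRange g).map fun i : Fin g => if (i : ℕ) < g₀ then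
            PuncturedSurfaceGroup.a (r := r) i * PuncturedSurfaceGroup.b i *
              (PuncturedSurfaceGroup.a i)⁻¹ * (PuncturedSurfaceGroup.b i)⁻¹ else 1).prod ∧
          G.vertGp v₀ = ((Subgroup.closure {x : PuncturedSurfaceGroup g r |
            (∃ i : Fin g, (i : ℕ) < g₀ ∧ (x = PuncturedSurfaceGroup.a i ∨ x = PuncturedSurfaceGroup.b i)) ∨
            ∃ j : Fin r, s ≤ (j : ℕ) ∧ x = PuncturedSurfaceGroup.c j}).map ι).topologicalClosure ∧
          G.vertGp v₁ = ((Subgroup.closure {x : PuncturedSurfaceGroup g r |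
            (∃ i : Fin g, g₀ ≤ (i : ℕ) ∧ (x = PuncturedSurfaceGroup.a i ∨ x = PuncturedSurfaceGroup.b i)) ∨
            (∃ j : Fin r, (j : ℕ) < s ∧ x = PuncturedSurfaceGroup.c j) ∨ x = ε}).map ι).topologicalClosure ∧
          G.nodeGp n₀ = ((Subgroup.zpowers ε).map ι).topologicalClosure ∧
          G.genus v₀ = g₀ ∧ G.genus v₁ = g - g₀ ∧ (∀ n, G.graph.nodeEnds n = s(v₀, v₁))) :
    OpenInterDeterminesComponentHolds Ω ∧ EdgeLikeIncidenceHolds Ω ∧ GraphicIffEdgeLikeVerticialHolds Ω ∧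
      (∀ ⦃Q : Type u⦄ [Group Q] [TopologicalSpace Q] [IsTopologicalGroup Q] (G : PSCDatum Q),
        Ω.IsOfPSCType G → G.VerticialEdgeLikeCommensurablyTerminal) ∧
      ((∀ ⦃Q : Type u⦄ [Group Q] [TopologicalSpace Q] (G : PSCDatum Q),
        Ω.IsOfPSCType G → ∃ v, G.genus v < 2) → CommensurableTerminalityHolds Ω) ∧
      (∀ ⦃Q : Type u⦄ [Group Q] [TopologicalSpace Q] [IsTopologicalGroup Q] (G : PSCDatum Q),
        Ω.IsOfPSCType G → CompactSpace Q ∧ T2Space Q ∧ TotallyDisconnectedSpace Q ∧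
        ∃ (S : Set ℕ) (g r g₀ s : ℕ) (ι : PuncturedSurfaceGroup g r →* Q) (e : G.graph.C ≃ Fin r)
          (v₀ v₁ : G.graph.V) (n₀ : G.graph.N) (ε : PuncturedSurfaceGroup g r),
          S.Nonempty ∧ (∀ p ∈ S, p.Prime) ∧ IsProSigmaCompletion S ι ∧ g₀ ≤ g ∧ 2 ≤ s ∧ s + 2 ≤ r ∧
          (∀ c, G.cuspGp c =
            ((PuncturedSurfaceGroup.cuspInertia (g := g) (e c)).map ι).topologicalClosure) ∧
          (∀ w, w = v₀ ∨ w = v₁) ∧ (∀ n, n = n₀) ∧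
          ε = ((List.finRange r).map fun j : Fin r =>
            if s ≤ (j : ℕ) then PuncturedSurfaceGroup.c (g := g) j else 1).prod *
          ((List.finRange g).map fun i : Fin g => if (i : ℕ) < g₀ then
            PuncturedSurfaceGroup.a (r := r) i * PuncturedSurfaceGroup.b i *
              (PuncturedSurfaceGroup.a i)⁻¹ * (PuncturedSurfaceGroup.b i)⁻¹ else 1).prod ∧
          G.vertGp v₀ = ((Subgroup.closure {x : PuncturedSurfaceGroup g r |
            (∃ i : Fin g, (i : ℕ) < g₀ ∧ (x = PuncturedSurfaceGroup.a i ∨ x = PuncturedSurfaceGroup.b i)) ∨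
            ∃ j : Fin r, s ≤ (j : ℕ) ∧ x = PuncturedSurfaceGroup.c j}).map ι).topologicalClosure ∧
          G.vertGp v₁ = ((Subgroup.closure {x : PuncturedSurfaceGroup g r |
            (∃ i : Fin g, g₀ ≤ (i : ℕ) ∧ (x = PuncturedSurfaceGroup.a i ∨ x = PuncturedSurfaceGroup.b i)) ∨
            (∃ j : Fin r, (j : ℕ) < s ∧ x = PuncturedSurfaceGroup.c j) ∨ x = ε}).map ι).topologicalClosure ∧
          G.nodeGp n₀ = ((Subgroup.zpowers ε).map ι).topologicalClosure ∧
          G.genus v₀ = g₀ ∧ G.genus v₁ = g - g₀) := by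
  -- (6) the gen-2 shape
  have hΩ₂ : (∀ ⦃Q : Type u⦄ [Group Q] [TopologicalSpace Q] [IsTopologicalGroup Q] (G : PSCDatum Q),
          Ω.IsOfPSCType G → CompactSpace Q ∧ T2Space Q ∧ TotallyDisconnectedSpace Q ∧
          ∃ (S : Set ℕ) (g r g₀ s : ℕ) (ι : PuncturedSurfaceGroup g r →* Q) (e : G.graph.C ≃ Fin r)
            (v₀ v₁ : G.graph.V) (n₀ : G.graph.N) (ε : PuncturedSurfaceGroup g r),
            S.Nonempty ∧ (∀ p ∈ S, p.Prime) ∧ IsProSigmaCompletion S ι ∧ g₀ ≤ g ∧ 2 ≤ s ∧ s + 2 ≤ r ∧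
            (∀ c, G.cuspGp c =
              ((PuncturedSurfaceGroup.cuspInertia (g := g) (e c)).map ι).topologicalClosure) ∧
            (∀ w, w = v₀ ∨ w = v₁) ∧ (∀ n, n = n₀) ∧
            ε = ((List.finRange r).map fun j : Fin r =>
              if s ≤ (j : ℕ) then PuncturedSurfaceGroup.c (g := g) j else 1).prod *
            ((List.finRange g).map fun i : Fin g => if (i : ℕ) < g₀ then
              PuncturedSurfaceGroup.a (r := r) i * PuncturedSurfaceGroup.b i *
                (PuncturedSurfaceGroup.a i)⁻¹ * (PuncturedSurfaceGroup.b i)⁻¹ else 1).prod ∧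
            G.vertGp v₀ = ((Subgroup.closure {x : PuncturedSurfaceGroup g r |
              (∃ i : Fin g, (i : ℕ) < g₀ ∧ (x = PuncturedSurfaceGroup.a i ∨ x = PuncturedSurfaceGroup.b i)) ∨
              ∃ j : Fin r, s ≤ (j : ℕ) ∧ x = PuncturedSurfaceGroup.c j}).map ι).topologicalClosure ∧
            G.vertGp v₁ = ((Subgroup.closure {x : PuncturedSurfaceGroup g r |
              (∃ i : Fin g, g₀ ≤ (i : ℕ) ∧ (x = PuncturedSurfaceGroup.a i ∨ x = PuncturedSurfaceGroup.b i)) ∨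
              (∃ j : Fin r, (j : ℕ) < s ∧ x = PuncturedSurfaceGroup.c j) ∨ x = ε}).map ι).topologicalClosure ∧
            G.nodeGp n₀ = ((Subgroup.zpowers ε).map ι).topologicalClosure ∧
            G.genus v₀ = g₀ ∧ G.genus v₁ = g - g₀) := fun Q _ _ _ G hG => by
    obtain ⟨_, hc, ht, hd, S, g, r, g₀, s, ι, e, v₀, v₁, n₀, ε, hne, hprime, hι, hg₀, hs, hsr, hC, hV, hN,
      hε, hV₀, hV₁, hE, hgen₀, hgen₁, -⟩ := hΩ G hG
    exact ⟨hc, ht, hd, S, g, r, g₀, s, ι, e, v₀, v₁, n₀, ε, hne, hprime, hι, hg₀, hs, hsr, hC, hV, hN, hε,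
      hV₀, hV₁, hE, hgen₀, hgen₁⟩
  have h12i : OpenInterDeterminesComponentHolds Ω :=
    openInterDeterminesComponentHolds_of_twoComponentAffine Ω hΩ₂
  -- (2) Prop. 1.5 (i)
  have h15i : EdgeLikeIncidenceHolds Ω := by
    intro Q _ _ G hG
    obtain ⟨_, hc, ht, hd, S, g, r, g₀, s, ι, e, v₀, v₁, n₀, ε, hne, hprime, hι, -, hs, hsr, hC, hV, hN,
      hε, hV₀, hV₁, hE, -⟩ := hΩ G hG
    exact G.edgeLikeIncidence_of_twoComponentAffine hne hprime ι hι hs hsr e hC v₀ v₁ hV ε hε hV₀ hV₁ n₀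
      hN hE
  -- (3) Prop. 1.5 (ii)
  have h15ii : GraphicIffEdgeLikeVerticialHolds Ω :=
    graphicIffEdgeLikeVerticialHolds_of_incidence Ω h12i h15i fun Q _ _ _ G hG => by
      obtain ⟨_, hc, ht, hd, S, g, r, g₀, s, ι, e, v₀, v₁, n₀, ε, hne, hprime, hι, -, hs, hsr, hC, hV, hN,
        hε, hV₀, hV₁, hE, -, -, hends⟩ := hΩ G hG
      exact G.branchLink_of_twoComponentAffine hne hprime ι hι hs hsr e hC v₀ v₁ hV ε hε hV₀ hV₁ n₀ hN hE
        hends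
  -- (4) Prop. 1.2 (ii), first clause, datum-wise
  have h12ii : ∀ ⦃Q : Type u⦄ [Group Q] [TopologicalSpace Q] [IsTopologicalGroup Q] (G : PSCDatum Q),
      Ω.IsOfPSCType G → G.VerticialEdgeLikeCommensurablyTerminal := fun Q _ _ _ G hG => by
    obtain ⟨_, hc, ht, hd, S, g, r, g₀, s, ι, e, v₀, v₁, n₀, ε, hne, hprime, hι, -, hs, hsr, hC, hV, hN,
      hε, hV₀, hV₁, hE, -⟩ := hΩ G hG
    exact G.verticialEdgeLikeCommensurablyTerminal_of_twoComponentAffine hne hprime ι hι hs hsr e hC v₀ v₁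
      hV ε hε hV₀ hV₁ n₀ hN hE
  refine ⟨h12i, h15i, h15ii, h12ii, fun hlt Q _ _ _ G hG => ?_, hΩ₂⟩
  -- (5) both clauses where a component has genus < 2
  obtain ⟨v, hv⟩ := hlt G hG
  exact ⟨h12ii G hG, G.unrVerticialCommensurablyTerminal_of_genus_lt_two v hv⟩

/-- **F-0461 / [CombGC] Thm. 1.6 (iii) is VACUOUS at every origin all of whose data have a component of
genus `< 2`**: the typed statement has the sturdiness of `G` (every component of genus `≥ 2`) as antecedent.
Recorded only to make the row's status at such origins explicit; no content.
[cite: MochizukiCombGC2007, Thm 1.6(iii) p.13] -/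
theorem unrVerticialIffHolds_of_genus_lt_two (Ω : PSCOrigin.{u})
    (hlt : ∀ ⦃Q : Type u⦄ [Group Q] [TopologicalSpace Q] (G : PSCDatum Q),
      Ω.IsOfPSCType G → ∃ v, G.genus v < 2) :
    UnrVerticialIffHolds Ω := by
  intro Q _ _ _ Q' _ _ _ G H β hG _ hGst _
  obtain ⟨v, hv⟩ := hlt G hG
  exact absurd (hGst v) (not_le.mpr hv)

/-! ### The origin with `Σ = {l}`: inhabited, and all five rows hold -/

/-- **At the origin of two-component affine data with `Σ = {l}` — inhabited, for EVERY splitting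
`g₀ ≤ g`, `2 ≤ s`, `s + 2 ≤ r`, by the genuine datum over a pro-`l` completion of `Γ_{g,r}` — F-0459
([CombGC] Prop. 1.2 (i)), F-0440 (Prop. 1.5 (i)), F-0443 (Prop. 1.5 (ii)), F-1931 ([IUTchI] Rmk. 1.2.3
(iv), cuspidal) and F-0458 (Thm. 1.6 (i)) all HOLD, and the verticial/edge-like clause of F-0438 (Prop. 1.2
(ii)) holds at every datum.**  First instance of Prop. 1.5 (ii) at multi-vertex data of arbitrary genera
(the two-tripod datum of abc-iut-L5-t6 has genus `0`). [cite: MochizukiCombGC2007, Prop 1.5(ii) p.13]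
[cite: MochizukiCombGC2007, Prop 1.5(i) p.12] [cite: MochizukiCombGC2007, Thm 1.6(i) p.13] -/
theorem exists_twoComponentAffineOrigin_prop15_holds (l : ℕ) (hl : l.Prime) :
    ∃ Ω : PSCOrigin.{0},
      (∀ g r g₀ s : ℕ, g₀ ≤ g → 2 ≤ s → s + 2 ≤ r →
        ∃ (Q : ProfiniteGrp.{0}) (ι : PuncturedSurfaceGroup g r →* Q) (G : PSCDatum Q),
          IsProSigmaCompletion {l} ι ∧ Ω.IsOfPSCType G ∧ G.Sigma = {l} ∧ G.graph.i = 2 ∧ G.graph.n = 1 ∧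
            G.graph.r = r ∧ (∃ v₀ v₁ : G.graph.V, (∀ w, w = v₀ ∨ w = v₁) ∧ G.genus v₀ = g₀ ∧
              G.genus v₁ = g - g₀) ∧
            ∀ c, ∃ j : Fin r, G.cuspGp c =
              ((PuncturedSurfaceGroup.cuspInertia (g := g) j).map ι).topologicalClosure) ∧
      OpenInterDeterminesComponentHolds Ω ∧ EdgeLikeIncidenceHolds Ω ∧
      GraphicIffEdgeLikeVerticialHolds Ω ∧ CuspidalEdgeLikeCharacterizationHolds Ω ∧
      NumericallyCuspidalIffHolds Ω ∧
      ∀ ⦃Q : Type⦄ [Group Q] [TopologicalSpace Q] [IsTopologicalGroup Q] (G : PSCDatum Q),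
        Ω.IsOfPSCType G → G.VerticialEdgeLikeCommensurablyTerminal := by
  classical
  let Ω : PSCOrigin.{0} :=
    ⟨fun {Q} _ _ G => G.Sigma = {l} ∧ ∃ (_ : IsTopologicalGroup Q), CompactSpace Q ∧ T2Space Q ∧
      TotallyDisconnectedSpace Q ∧
      ∃ (S : Set ℕ) (g r g₀ s : ℕ) (ι : PuncturedSurfaceGroup g r →* Q) (e : G.graph.C ≃ Fin r)
        (v₀ v₁ : G.graph.V) (n₀ : G.graph.N) (ε : PuncturedSurfaceGroup g r),
        S.Nonempty ∧ (∀ p ∈ S, p.Prime) ∧ IsProSigmaCompletion S ι ∧ g₀ ≤ g ∧ 2 ≤ s ∧ s + 2 ≤ r ∧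
        (∀ c, G.cuspGp c =
          ((PuncturedSurfaceGroup.cuspInertia (g := g) (e c)).map ι).topologicalClosure) ∧
        (∀ w, w = v₀ ∨ w = v₁) ∧ (∀ n, n = n₀) ∧
        ε = ((List.finRange r).map fun j : Fin r =>
          if s ≤ (j : ℕ) then PuncturedSurfaceGroup.c (g := g) j else 1).prod *
        ((List.finRange g).map fun i : Fin g => if (i : ℕ) < g₀ then
          PuncturedSurfaceGroup.a (r := r) i * PuncturedSurfaceGroup.b i *
            (PuncturedSurfaceGroup.a i)⁻¹ * (PuncturedSurfaceGroup.b i)⁻¹ else 1).prod ∧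
        G.vertGp v₀ = ((Subgroup.closure {x : PuncturedSurfaceGroup g r |
          (∃ i : Fin g, (i : ℕ) < g₀ ∧ (x = PuncturedSurfaceGroup.a i ∨ x = PuncturedSurfaceGroup.b i)) ∨
          ∃ j : Fin r, s ≤ (j : ℕ) ∧ x = PuncturedSurfaceGroup.c j}).map ι).topologicalClosure ∧
        G.vertGp v₁ = ((Subgroup.closure {x : PuncturedSurfaceGroup g r |
          (∃ i : Fin g, g₀ ≤ (i : ℕ) ∧ (x = PuncturedSurfaceGroup.a i ∨ x = PuncturedSurfaceGroup.b i)) ∨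
          (∃ j : Fin r, (j : ℕ) < s ∧ x = PuncturedSurfaceGroup.c j) ∨ x = ε}).map ι).topologicalClosure ∧
        G.nodeGp n₀ = ((Subgroup.zpowers ε).map ι).topologicalClosure ∧
        G.genus v₀ = g₀ ∧ G.genus v₁ = g - g₀ ∧ (∀ n, G.graph.nodeEnds n = s(v₀, v₁))⟩
  have hSig : ∀ ⦃Q : Type⦄ [Group Q] [TopologicalSpace Q] [IsTopologicalGroup Q] (G : PSCDatum Q),
      Ω.IsOfPSCType G → G.Sigma = {l} := fun Q _ _ _ G hG => hG.1
  have hl' : ∀ p ∈ ({l} : Set ℕ), p.Prime := fun p hp => by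
    rw [Set.mem_singleton_iff.mp hp]; exact hl
  obtain ⟨h12i, h15i, h15ii, h12ii, -, hΩ₂⟩ := twoComponentAffineOrigin_rows Ω (fun Q _ _ G hG => hG.2)
  refine ⟨Ω, fun g r g₀ s hg₀ hs hsr => ?_, h12i, h15i, h15ii,
    cuspidalEdgeLikeCharacterizationHolds_of_cuspidallyStandard Ω (fun Q _ _ _ G hG => ?_),
    numericallyCuspidalIffHolds_of_twoComponentAffine Ω l hΩ₂ hSig, h12ii⟩
  · -- membership of the genuine datum
    obtain ⟨Q, ι, G, e, v₀, v₁, n₀, ε, hι, hS, hi, hn, hr, hC, hV, hN, hε, hV₀, hV₁, hE, hgen₀, hgen₁,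
      hends, -⟩ := exists_twoComponentAffineDatum {l} ⟨l, rfl⟩ hl' g r g₀ s
    exact ⟨Q, ι, G, hι, ⟨hS, inferInstance, inferInstance, inferInstance, inferInstance, {l}, g, r, g₀, s,
      ι, e, v₀, v₁, n₀, ε, ⟨l, rfl⟩, hl', hι, hg₀, hs, hsr, hC, hV, hN, hε, hV₀, hV₁, hE, hgen₀, hgen₁,
      hends⟩, hS, hi, hn, hr, ⟨v₀, v₁, hV, hgen₀, hgen₁⟩, fun c => ⟨e c, hC c⟩⟩
  · obtain ⟨hc, ht, hd, S, g, r, g₀, s, ι, e, v₀, v₁, n₀, ε, hne, hprime, hι, hg₀, hs, hsr, hC, -⟩ :=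
      hΩ₂ G hG
    exact ⟨hc, ht, hd, S, g, r, ι, e, hne, hprime,
      by unfold PuncturedSurfaceGroup.IsHyperbolicType; omega, hι, hC⟩

/-- **At the origin of two-component affine data with `Σ = {l}` and a component of genus `≤ 1` (`g₀ ≤ 1`)
— inhabited (e.g. an elliptic or rational component `C₀` glued to a genus-`g₁` component, every `g₁`, every
admissible distribution of `r ≥ 4` cusps) — ALL of F-0438 ([CombGC] Prop. 1.2 (ii), both clauses), F-0459,
F-0440, F-0443, F-1931, F-0458 HOLD** (and F-0461, Thm. 1.6 (iii), VACUOUSLY: no datum is sturdy).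
[cite: MochizukiCombGC2007, Prop 1.2(ii) p.8]
[cite: MochizukiCombGC2007, Prop 1.5(ii) p.13] [cite: MochizukiCombGC2007, Thm 1.6(i) p.13] -/
theorem exists_twoComponentAffineOrigin_prop12ii_holds (l : ℕ) (hl : l.Prime) :
    ∃ Ω : PSCOrigin.{0},
      (∀ g r g₀ s : ℕ, g₀ ≤ 1 → g₀ ≤ g → 2 ≤ s → s + 2 ≤ r →
        ∃ (Q : ProfiniteGrp.{0}) (ι : PuncturedSurfaceGroup g r →* Q) (G : PSCDatum Q),
          IsProSigmaCompletion {l} ι ∧ Ω.IsOfPSCType G ∧ G.Sigma = {l} ∧ G.graph.i = 2 ∧ G.graph.n = 1 ∧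
            G.graph.r = r ∧ (∃ v₀ v₁ : G.graph.V, (∀ w, w = v₀ ∨ w = v₁) ∧ G.genus v₀ = g₀ ∧
              G.genus v₁ = g - g₀)) ∧
      CommensurableTerminalityHolds Ω ∧ OpenInterDeterminesComponentHolds Ω ∧ EdgeLikeIncidenceHolds Ω ∧
      GraphicIffEdgeLikeVerticialHolds Ω ∧ CuspidalEdgeLikeCharacterizationHolds Ω ∧
      NumericallyCuspidalIffHolds Ω ∧ UnrVerticialIffHolds Ω := by
  classical
  let Ω : PSCOrigin.{0} :=
    ⟨fun {Q} _ _ G => G.Sigma = {l} ∧ (∃ v, G.genus v < 2) ∧ ∃ (_ : IsTopologicalGroup Q),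
      CompactSpace Q ∧ T2Space Q ∧ TotallyDisconnectedSpace Q ∧
      ∃ (S : Set ℕ) (g r g₀ s : ℕ) (ι : PuncturedSurfaceGroup g r →* Q) (e : G.graph.C ≃ Fin r)
        (v₀ v₁ : G.graph.V) (n₀ : G.graph.N) (ε : PuncturedSurfaceGroup g r),
        S.Nonempty ∧ (∀ p ∈ S, p.Prime) ∧ IsProSigmaCompletion S ι ∧ g₀ ≤ g ∧ 2 ≤ s ∧ s + 2 ≤ r ∧
        (∀ c, G.cuspGp c =
          ((PuncturedSurfaceGroup.cuspInertia (g := g) (e c)).map ι).topologicalClosure) ∧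
        (∀ w, w = v₀ ∨ w = v₁) ∧ (∀ n, n = n₀) ∧
        ε = ((List.finRange r).map fun j : Fin r =>
          if s ≤ (j : ℕ) then PuncturedSurfaceGroup.c (g := g) j else 1).prod *
        ((List.finRange g).map fun i : Fin g => if (i : ℕ) < g₀ then
          PuncturedSurfaceGroup.a (r := r) i * PuncturedSurfaceGroup.b i *
            (PuncturedSurfaceGroup.a i)⁻¹ * (PuncturedSurfaceGroup.b i)⁻¹ else 1).prod ∧
        G.vertGp v₀ = ((Subgroup.closure {x : PuncturedSurfaceGroup g r |
          (∃ i : Fin g, (i : ℕ) < g₀ ∧ (x = PuncturedSurfaceGroup.a i ∨ x = PuncturedSurfaceGroup.b i)) ∨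
          ∃ j : Fin r, s ≤ (j : ℕ) ∧ x = PuncturedSurfaceGroup.c j}).map ι).topologicalClosure ∧
        G.vertGp v₁ = ((Subgroup.closure {x : PuncturedSurfaceGroup g r |
          (∃ i : Fin g, g₀ ≤ (i : ℕ) ∧ (x = PuncturedSurfaceGroup.a i ∨ x = PuncturedSurfaceGroup.b i)) ∨
          (∃ j : Fin r, (j : ℕ) < s ∧ x = PuncturedSurfaceGroup.c j) ∨ x = ε}).map ι).topologicalClosure ∧
        G.nodeGp n₀ = ((Subgroup.zpowers ε).map ι).topologicalClosure ∧
        G.genus v₀ = g₀ ∧ G.genus v₁ = g - g₀ ∧ (∀ n, G.graph.nodeEnds n = s(v₀, v₁))⟩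
  have hSig : ∀ ⦃Q : Type⦄ [Group Q] [TopologicalSpace Q] [IsTopologicalGroup Q] (G : PSCDatum Q),
      Ω.IsOfPSCType G → G.Sigma = {l} := fun Q _ _ _ G hG => hG.1
  have hl' : ∀ p ∈ ({l} : Set ℕ), p.Prime := fun p hp => by
    rw [Set.mem_singleton_iff.mp hp]; exact hl
  obtain ⟨h12i, h15i, h15ii, -, h12ii, hΩ₂⟩ :=
    twoComponentAffineOrigin_rows Ω (fun Q _ _ G hG => hG.2.2)
  refine ⟨Ω, fun g r g₀ s hg₁ hg₀ hs hsr => ?_, h12ii (fun Q _ _ G hG => hG.2.1), h12i, h15i, h15ii,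
    cuspidalEdgeLikeCharacterizationHolds_of_cuspidallyStandard Ω (fun Q _ _ _ G hG => ?_),
    numericallyCuspidalIffHolds_of_twoComponentAffine Ω l hΩ₂ hSig,
    unrVerticialIffHolds_of_genus_lt_two Ω (fun Q _ _ G hG => hG.2.1)⟩
  · obtain ⟨Q, ι, G, e, v₀, v₁, n₀, ε, hι, hS, hi, hn, hr, hC, hV, hN, hε, hV₀, hV₁, hE, hgen₀, hgen₁,
      hends, -⟩ := exists_twoComponentAffineDatum {l} ⟨l, rfl⟩ hl' g r g₀ s
    exact ⟨Q, ι, G, hι, ⟨hS, ⟨v₀, by rw [hgen₀]; omega⟩, inferInstance, inferInstance, inferInstance,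
      inferInstance, {l}, g, r, g₀, s, ι, e, v₀, v₁, n₀, ε, ⟨l, rfl⟩, hl', hι, hg₀, hs, hsr, hC, hV, hN,
      hε, hV₀, hV₁, hE, hgen₀, hgen₁, hends⟩, hS, hi, hn, hr, ⟨v₀, v₁, hV, hgen₀, hgen₁⟩⟩
  · obtain ⟨hc, ht, hd, S, g, r, g₀, s, ι, e, v₀, v₁, n₀, ε, hne, hprime, hι, hg₀, hs, hsr, hC, -⟩ :=
      hΩ₂ G hG
    exact ⟨hc, ht, hd, S, g, r, ι, e, hne, hprime,
      by unfold PuncturedSurfaceGroup.IsHyperbolicType; omega, hι, hC⟩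

end PSCDatum

end Literature.AnabelianGeometry.SemiGraphs

end
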